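import Mathlib
import Summits.KontsevichZagierPeriods.KontsevichZagierPeriods.Theses.SymplecticScissors

/-!
# Sketch — crux-ideate stmt-KontsevichZagierPeriods-3814 (`VolumeForm`), ideator 1, round 1

First lemmas of card `ruled-stacks-archimedes` (all over existing declarations; nothing proved here).
-/

noncomputable section

namespace Summit.KontsevichZagierPeriods.KontsevichZagierPeriods.Cruxes.VolumeForm.RuledStacksArchimedes

open Literature.NumberTheory.Transcendental

/-- SOLID HAT-BOX (Archimedes as ONE rule-2 move in ℝ³): the map
`(x,y,z) ↦ (x·s, y·s, z)`, `s = √(x²+y²+z²)/√(x²+y²)` (cylindrical radius `ρ ↦ √(ρ²+z²)`, so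
`ρ' dρ' = ρ dρ` at fixed `z`, `|det| = 1`), carries the open unit ball minus the `z`-axis onto the
solid cylinder minus the closed double cone `{z² < x²+y² < 1}`. -/
def SolidHatBox : Prop :=
  ∀ (r r' : KZ.IntegralRep 3),
    r.domain = {p | p 0 ^ 2 + p 1 ^ 2 + p 2 ^ 2 < 1 ∧ 0 < p 0 ^ 2 + p 1 ^ 2} →
    r'.domain = {q | q 2 ^ 2 < q 0 ^ 2 + q 1 ^ 2 ∧ q 0 ^ 2 + q 1 ^ 2 < 1} →
    (∀ p ∈ r.domain, r.integrand p = 1) → (∀ q ∈ r'.domain, r'.integrand q = 1) →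
    KZ.of r - KZ.of r' ∈ KZ.changeOfVariablesRel


/-- ODD-BALL FLATTENING (cleanest Archimedean move): `Φ(x,y,z) = (x/√(1−z²), y/√(1−z²), z − z³/3)` has
`det DΦ = (1−z²)⁻¹ · (1−z²) = 1`, is injective and ℚ-semialgebraic on the open unit ball, and maps it onto the
cylinder `{u²+v² < 1} × (−2/3, 2/3)`: "odd balls are cylinders over even balls" (`B^{2m+1} ~ B^{2m} × (0,c_m)`,
`c_m = ∫₋₁¹ (1−z²)^m dz ∈ ℚ`). -/
def OddBallCylinder : Prop :=
  ∀ (r r' : KZ.IntegralRep 3),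
    r.domain = {p | p 0 ^ 2 + p 1 ^ 2 + p 2 ^ 2 < 1} →
    r'.domain = {q | q 0 ^ 2 + q 1 ^ 2 < 1 ∧ -(2 / 3 : ℝ) < q 2 ∧ q 2 < 2 / 3} →
    (∀ p ∈ r.domain, r.integrand p = 1) → (∀ q ∈ r'.domain, r'.integrand q = 1) →
    KZ.of r - KZ.of r' ∈ KZ.changeOfVariablesRel

/-- DEMOCRITUS–ARCHIMEDES CONE MAP (ONE rule-2 move): `(x,y,z) ↦ (x/z, y/z, z³/3)` has `det = 1` on
`{z > 0}` and carries the open cone `{x²+y² < z², 0 < z < 1}` onto the cylinder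
`{u²+v² < 1} × (0, 1/3)`.  General `N`: `(x', x_N) ↦ (x'/x_N, x_N^N/N)` ("cone = cylinder / N",
the perspective map of the radial calculus). -/
def ConeThird : Prop :=
  ∀ (r r' : KZ.IntegralRep 3),
    r.domain = {p | p 0 ^ 2 + p 1 ^ 2 < p 2 ^ 2 ∧ 0 < p 2 ∧ p 2 < 1} →
    r'.domain = {q | q 0 ^ 2 + q 1 ^ 2 < 1 ∧ 0 < q 2 ∧ q 2 < 1 / 3} →
    (∀ p ∈ r.domain, r.integrand p = 1) → (∀ q ∈ r'.domain, r'.integrand q = 1) →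
    KZ.of r - KZ.of r' ∈ KZ.changeOfVariablesRel

/-- PERSPECTIVE MAP in dimension `N+1` (radial shadow as one move): for a bounded ℚ-semialgebraic
set `A ⊆ {x_N > 0}` that is a radial subgraph `A = {t • (u,1) | u ∈ U, 0 < t < R u}` over a
gnomonic base `U ⊆ ℝ^N` with `x_N`-extent `R` along the ray, the map `(x', x_N) ↦ (x'/x_N, x_N^(N+1)/(N+1))`
(`|det| = 1`) carries `A` onto the flat subgraph `{(u,s) | u ∈ U, 0 < s < (R u)^(N+1)/(N+1)}`. -/
def PerspectiveMap : Prop :=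
  ∀ (N : ℕ) (U : Set (Fin N → ℝ)) (R : (Fin N → ℝ) → ℝ) (r r' : KZ.IntegralRep (N + 1)),
    Literature.ModelTheory.ExponentialFields.IsSemialgebraic ℚ U →
    IsSemialgebraicFunOn ℚ U R → (∀ u ∈ U, 0 < R u) →
    r.domain = {p | 0 < p (Fin.last N) ∧ (fun i : Fin N => p (Fin.castSucc i) / p (Fin.last N)) ∈ U ∧
      p (Fin.last N) < R (fun i : Fin N => p (Fin.castSucc i) / p (Fin.last N))} →
    r'.domain = {q | (fun i : Fin N => q (Fin.castSucc i)) ∈ U ∧ 0 < q (Fin.last N) ∧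
      q (Fin.last N) < R (fun i : Fin N => q (Fin.castSucc i)) ^ (N + 1) / (N + 1)} →
    (∀ p ∈ r.domain, r.integrand p = 1) → (∀ q ∈ r'.domain, r'.integrand q = 1) →
    KZ.of r - KZ.of r' ∈ KZ.changeOfVariablesRel

/-- TRIANGULAR STACKS in ℝ³: the solid swept by an open triangle with ℚ-semialgebraic `C¹` vertex
curves `v₀ v₁ v₂ : (a,b) → ℝ²` (non-degenerate), `A = {(t,y) | a < t < b, y ∈ Δ(v₀ t, v₁ t, v₂ t)}`. -/
def IsTriangularStack (a b : ℝ) (v : Fin 3 → ℝ → Fin 2 → ℝ) (S : Set (Fin 3 → ℝ)) : Prop :=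
  a < b ∧ (∀ j, IsSemialgebraicMapOn ℚ {z : Fin 1 → ℝ | z 0 ∈ Set.Ioo a b} (fun z => v j (z 0))) ∧
  (∀ j, ContDiffOn ℝ 1 (v j) (Set.Ioo a b)) ∧
  (∀ t ∈ Set.Ioo a b, (v 1 t 0 - v 0 t 0) * (v 2 t 1 - v 0 t 1) - (v 1 t 1 - v 0 t 1) * (v 2 t 0 - v 0 t 0) ≠ 0) ∧
  S = {p | p 0 ∈ Set.Ioo a b ∧ ∃ l m : ℝ, 0 < l ∧ 0 < m ∧ l + m < 1 ∧
        p 1 = v 0 (p 0) 0 + l * (v 1 (p 0) 0 - v 0 (p 0) 0) + m * (v 2 (p 0) 0 - v 0 (p 0) 0) ∧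
        p 2 = v 0 (p 0) 1 + l * (v 1 (p 0) 1 - v 0 (p 0) 1) + m * (v 2 (p 0) 1 - v 0 (p 0) 1)}

/-- STACK REDUCTION (provable now; the transfer lemma of the card at `N = 3`): a triangular stack
is KZ-equivalent to the PLANAR subgraph of its slice-area function
`α(t) = |det(v₁ t − v₀ t, v₂ t − v₀ t)| / 2` — one fibred affine change of variables
`(t, y) ↦ (t, M(t)⁻¹ (y − v₀ t))` onto `(a,b) × Δ_std` with integrand `|det M(t)|` (a function of `t`
alone), then slab/Fubini moves of the tree (`CylinderReduction`-type). -/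
def StackReduction : Prop :=
  ∀ (a b : ℝ) (v : Fin 3 → ℝ → Fin 2 → ℝ) (r : KZ.IntegralRep 3) (s : KZ.IntegralRep 2),
    IsTriangularStack a b v r.domain → (∀ p ∈ r.domain, r.integrand p = 1) →
    s.domain = {q | q 0 ∈ Set.Ioo a b ∧ 0 < q 1 ∧
      q 1 < |(v 1 (q 0) 0 - v 0 (q 0) 0) * (v 2 (q 0) 1 - v 0 (q 0) 1)
              - (v 1 (q 0) 1 - v 0 (q 0) 1) * (v 2 (q 0) 0 - v 0 (q 0) 0)| / 2} →
    (∀ q ∈ s.domain, s.integrand q = 1) →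
    KZ.Equivalent r s

/-- The SECTOR TRANSFER: on triangular stacks the frame `VolumeForm` (crux 3814) follows from the
planar layer `PlanarAreas` (crux stmt-4990, itself closing modulo `RealOnePeriodRelations` 10042):
two triangular stacks of equal volume are KZ-equivalent. Proof plan: `StackReduction` twice +
`PlanarAreas` on the two planar subgraphs + transitivity. -/
def StackSector : Prop :=
  Summit.KontsevichZagierPeriods.KontsevichZagierPeriods.Theses.SymplecticScissors.PlanarAreas →
    ∀ (a b a' b' : ℝ) (v v' : Fin 3 → ℝ → Fin 2 → ℝ) (r r' : KZ.IntegralRep 3),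
      IsTriangularStack a b v r.domain → IsTriangularStack a' b' v' r'.domain →
      (∀ p ∈ r.domain, r.integrand p = 1) → (∀ p ∈ r'.domain, r'.integrand p = 1) →
      r.value = r'.value → KZ.Equivalent r r'

/-- Glue (pure logic, checkable now): `StackReduction` and `PlanarAreas` give `StackSector`. -/
def StackSectorGlue : Prop := StackReduction → StackSector

example : Summit.KontsevichZagierPeriods.KontsevichZagierPeriods.Theses.SymplecticScissors.VolumeForm →
    Summit.KontsevichZagierPeriods.KontsevichZagierPeriods.Theses.SymplecticScissors.PlanarAreas :=
  fun h r r' hr hr' hv => h r r' hr hr' hv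

end Summit.KontsevichZagierPeriods.KontsevichZagierPeriods.Cruxes.VolumeForm.RuledStacksArchimedes
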